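import Literature.NumberTheory.EllipticCurves.NeronComponentDataAssembly
import Literature.NumberTheory.EllipticCurves.NeronComponentIndexProofs
import Literature.NumberTheory.EllipticCurves.NeronComponentIndexTypeIIIProofs
import Literature.NumberTheory.EllipticCurves.NeronComponentIndexTypeIIIstarProofs
import Literature.NumberTheory.EllipticCurves.NeronComponentIndexTypeIVProofs
import Literature.NumberTheory.EllipticCurves.NeronComponentIndexTypeIVstarProofs
import Literature.NumberTheory.EllipticCurves.NeronComponentIndexTypeI0starProofs
import Literature.NumberTheory.EllipticCurves.NeronComponentIndexTypeInstarProofs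
import Literature.NumberTheory.EllipticCurves.NeronComponentIndexSplitProofs
import Literature.NumberTheory.EllipticCurves.NonsplitProofs
import HarnessLib

/-!
# The Néron component datum exists: `nonempty_neronComponentData` (proof)

Discharge of the named fact `Literature.NumberTheory.EllipticCurves.nonempty_neronComponentData`
(`NeronModel.lean`): for an elliptic curve `W/K` and a finite place `v` with finite residue
field there is a `NeronComponentData W v` — a finite abelian group `Φ` of order the
component-group order of the Kodaira symbol at `v` with an automorphism `frob` whose fixed
points are `E(K_v)/E₀(K_v)` (Kodaira–Néron: `Φ = 𝓔/𝓔⁰ (k̄)` with its Frobenius, and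
`E(K_v)/E₀(K_v) ≅ Φ(k)`; Silverman, *ATAEC*, Cor. IV.9.2 and Thm. IV.9.4 with Table 4.1).

The proof is the case analysis of `nonempty_neronComponentData_of_localIndex`
(`NeronComponentDataAssembly.lean`) on the Kodaira symbol, fed with the local indices
`c_v = [E(K_v) : E₀(K_v)]` computed *elementarily* (no Néron model) in this series of files:

| type | `c_v` | file |
|---|---|---|
| `I₀` | `1` | tree (`localTamagawaNumber_eq_one_of_good'`) |
| `Iₙ` split | `n` | `NeronComponentIndexSplitProofs` |
| `Iₙ` non-split | `2` / `1` by parity of `n` | `NonsplitProofs` |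
| `II`, `II*` | `1` | `NeronComponentIndexProofs` |
| `III`, `III*` | `2` | `NeronComponentIndexTypeIIIProofs`, `…TypeIIIstarProofs` |
| `IV`, `IV*` | `1` or `3` | `NeronComponentIndexTypeIVProofs`, `…TypeIVstarProofs` |
| `I₀*` | `1`, `2` or `4` | `NeronComponentIndexTypeI0starProofs` |
| `Iₙ*`, `n ≥ 1` | `2` or `4` | `NeronComponentIndexTypeInstarProofs` |

and in each case `Φ` is `E(K_v)/E₀(K_v)` itself (all components rational), `ℤ/n` with
`frob = −1`, or the Klein four group with a swap (`NeronComponentDataAssembly`).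

## References

* J. H. Silverman, *Advanced Topics in the Arithmetic of Elliptic Curves*, GTM 151, Springer
  1994, Cor. IV.9.2 (PDF p. 340), Thm. IV.9.4 and Table 4.1 (PDF pp. 341–346).
  [SilvermanATAEC1994]
* A. Néron, *Modèles minimaux des variétés abéliennes sur les corps locaux et globaux*,
  Publ. Math. IHÉS 21 (1964). [Neron1964]
-/

noncomputable section

open scoped Classical

namespace Literature.NumberTheory.EllipticCurves

open IsDedekindDomain

variable {A : Type*} [CommRing A] [IsDedekindDomain A] {K : Type*} [Field K] [Algebra A K]
  [IsFractionRing A K] (W : WeierstrassCurve K) (v : HeightOneSpectrum A)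

/-- **The Néron component datum exists** (discharge of `nonempty_neronComponentData`): for
`W` elliptic and `v` with finite residue field, `Nonempty (NeronComponentData W v)`
(Kodaira–Néron; Silverman, *ATAEC*, Cor. IV.9.2 and Thm. IV.9.4 with Table 4.1), by the case
analysis of `nonempty_neronComponentData_of_localIndex` with the elementary local indices of
this series; the split multiplicative case uses `c_v = ord_v(Δ_min)`
(`localTamagawaNumber_eq_ordMinimalDiscriminant_of_hasSplitMultiplicativeReductionAt`)
directly. [cite: SilvermanATAEC1994, Cor. IV.9.2 and Thm. IV.9.4 (PDF pp. 340–346)] -/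
theorem nonempty_neronComponentData_holds : nonempty_neronComponentData W v := by
  intro _ _
  rcases hk : W.kodairaSymbolAt v with (_ | m) | _ | _ | _ | (_ | n) | _ | _ | _
  · -- `I₀`: good reduction, `c = 1`
    have hg : W.HasGoodReductionAt v :=
      (WeierstrassCurve.isGood_kodairaSymbolAt_iff_holds v W).mp hk
    refine nonempty_neronComponentData_of_eq_componentGroupOrder ?_
    rw [hk, localTamagawaNumber_eq_one_of_good' v W
      (WeierstrassCurve.localTamagawaNumber_eq_one_of_hasGoodReduction_holds _ _) hg]
    rfl
  · -- `Iₘ₊₁`: multiplicative reduction, `m + 1 = ord_v(Δ_min)`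
    obtain ⟨hmult, hord⟩ :=
      (WeierstrassCurve.kodairaSymbolAt_eq_I_iff_holds v W m.succ_ne_zero).mp hk
    by_cases hs : W.HasSplitMultiplicativeReductionAt v
    · refine nonempty_neronComponentData_of_eq_componentGroupOrder ?_
      rw [localTamagawaNumber_eq_ordMinimalDiscriminant_of_hasSplitMultiplicativeReductionAt v W
        hs, hord, hk, DiophantineGeometry.KodairaSymbol.componentGroupOrder_I]
      exact (max_eq_left m.succ_pos).symm
    · have hcgo : (W.kodairaSymbolAt v).componentGroupOrder = m + 1 := by
        rw [hk, DiophantineGeometry.KodairaSymbol.componentGroupOrder_I]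
        exact max_eq_left m.succ_pos
      refine nonempty_neronComponentData_of_neg (by rw [hcgo]; exact m.succ_ne_zero) ?_
      rw [localTamagawaNumber_of_hasNonsplitMultiplicativeReductionAt_holds v W hmult hs, hord,
        hcgo]
  · -- `II`
    exact nonempty_neronComponentData_of_eq_componentGroupOrder
      (by rw [localTamagawaNumber_eq_one_of_kodairaSymbolAt_eq_II_holds v W hk, hk]; rfl)
  · -- `III`
    exact nonempty_neronComponentData_of_eq_componentGroupOrder
      (by rw [localTamagawaNumber_eq_two_of_kodairaSymbolAt_eq_III_holds v W hk, hk]; rfl)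
  · -- `IV`
    rcases localTamagawaNumber_of_kodairaSymbolAt_eq_IV_holds v W hk with h | h
    · exact nonempty_neronComponentData_of_neg (by rw [hk]; decide) (by rw [h, hk]; decide)
    · exact nonempty_neronComponentData_of_eq_componentGroupOrder (by rw [h, hk]; rfl)
  · -- `I₀*`
    rcases localTamagawaNumber_of_kodairaSymbolAt_eq_Istar_zero_holds v W hk with h | h | h
    · exact nonempty_neronComponentData_of_klein (by rw [hk]; rfl) h
    · exact nonempty_neronComponentData_of_neg (by rw [hk]; decide) (by rw [h, hk]; decide)
    · exact nonempty_neronComponentData_of_eq_componentGroupOrder (by rw [h, hk]; rfl)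
  · -- `Iₙ₊₁*`
    rcases localTamagawaNumber_of_kodairaSymbolAt_eq_Istar_succ_holds v W n hk with h | h
    · exact nonempty_neronComponentData_of_neg
        (by rw [hk, DiophantineGeometry.KodairaSymbol.componentGroupOrder_Istar]; decide)
        (by rw [h, hk, DiophantineGeometry.KodairaSymbol.componentGroupOrder_Istar]; decide)
    · exact nonempty_neronComponentData_of_eq_componentGroupOrder (by rw [h, hk]; rfl)
  · -- `IV*`
    rcases localTamagawaNumber_of_kodairaSymbolAt_eq_IVstar_holds v W hk with h | h
    · exact nonempty_neronComponentData_of_neg (by rw [hk]; decide) (by rw [h, hk]; decide)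
    · exact nonempty_neronComponentData_of_eq_componentGroupOrder (by rw [h, hk]; rfl)
  · -- `III*`
    exact nonempty_neronComponentData_of_eq_componentGroupOrder
      (by rw [localTamagawaNumber_eq_two_of_kodairaSymbolAt_eq_IIIstar_holds v W hk, hk]; rfl)
  · -- `II*`
    exact nonempty_neronComponentData_of_eq_componentGroupOrder
      (by rw [localTamagawaNumber_eq_one_of_kodairaSymbolAt_eq_IIstar_holds v W hk, hk]; rfl)

/-- The assembly route also closes: `nonempty_neronComponentData` from
`nonempty_neronComponentData_of_localIndex` needs, besides the nine discharged local-index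
facts, only the Kodaira–Néron fact for split multiplicative reduction; here is the version fed
with everything proved in the tree except that input. [folklore] -/
theorem nonempty_neronComponentData_of_kodairaNeron
    (hKN : (W.localMinimalModel v).index_goodReductionSubgroup_of_hasSplitMultiplicativeReduction
      (v.adicCompletionIntegers K)) :
    nonempty_neronComponentData W v := by
  intro _ _
  exact nonempty_neronComponentData_of_localIndex v W
    (localTamagawaNumber_eq_one_of_kodairaSymbolAt_eq_II_holds v W)
    (localTamagawaNumber_eq_two_of_kodairaSymbolAt_eq_III_holds v W)
    (localTamagawaNumber_of_kodairaSymbolAt_eq_IV_holds v W)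
    (localTamagawaNumber_of_kodairaSymbolAt_eq_Istar_zero_holds v W)
    (localTamagawaNumber_of_kodairaSymbolAt_eq_Istar_succ_holds v W)
    (localTamagawaNumber_of_kodairaSymbolAt_eq_IVstar_holds v W)
    (localTamagawaNumber_eq_two_of_kodairaSymbolAt_eq_IIIstar_holds v W)
    (localTamagawaNumber_eq_one_of_kodairaSymbolAt_eq_IIstar_holds v W) hKN
    (localTamagawaNumber_of_hasNonsplitMultiplicativeReductionAt_holds v W)

end Literature.NumberTheory.EllipticCurves

end
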